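import Summits.BirchSwinnertonDyer.Rank1Residual.P2.CongruentNumberSilentEvenFiveRankDescent
import Summits.BirchSwinnertonDyer.Rank1Residual.P2.CongruentNumberEvenFiveSelmerExact
import Literature.NumberTheory.EllipticCurves.Tian2014.CMPointSystemPiPrimeClass
import Literature.NumberTheory.EllipticCurves.Tian2014.CMPointSystemGenusBridgeThreeModEight
import HarnessLib

/-!
# Cell «bsd-monsky» (prover-A, g12): MONSKY'S ODD-INDEX THEOREM (Math. Z. 204, Thm. 5.14 (13)/(15) with Remark (2): «the
# subgroup generated by `S_N` and `T` is of odd index», rank `E_N(ℚ) = 1`) RE-PROVED FOR TIAN'S HEEGNER POINT `y_N` on the silent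
# half `𝒮⁻` — the algebraic half of the first proof — from the GALOIS SKELETON of Tian's CM-point system and genus theory ALONE:
# no Gross–Zagier display, no `2`-Selmer display, no reading mark

HONEST FRAMING (cell `bsd-monsky`, run/shared/lean/pub/bsd-monsky/, README §1: ONE theorem on ONE explicit infinite
family of quadratic twists of the congruent number curve at the prime `2`; nothing booked). This file asserts NO
arithmetic fact and claims NOTHING new on paper: Monsky PROVED (Thm. 5.14 (13)/(15), Cor. 5.15, Remark (2), pp. 65–67),
for all `N ∈ 𝒮` and with no Legendre condition, that his mock Heegner point `S_N ∈ E_N(ℚ)` has odd index modulo torsion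
and that `rank E_N(ℚ) = 1`; his Remark (3) (p. 67) is the general-`ℓ` suspicion («`S_N` … divisible by `2^{ℓ−2}`, but not by
`2^{ℓ−1}`, in `Λ_N/T`»), whose `ℓ = 2` case IS that theorem. The cell's Theorem 1.1 is the ANALYTIC companion — clause (a)
`ord_{s=1} L = 1` and the `2`-part — and its first proof re-proves the odd-index statement for TIAN'S Heegner point `y_N`
on `X₀(32)` (not transported from `S_N`, whose identification with `±y_N` mod `E_N[2]` is asserted in Tian 2014 Remark 2.5
but not proved in print) and then converts it through the explicit Gross–Zagier formula (TYZ Thm. 3.3).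

Every corner of record of the cell (referee B ROUND 742: `…_of_autSystemReduced_descent (hSys⁸)`, route A) displays,
inside its one hypothesis, that Gross–Zagier conjunct `GrossZagierAut` — TYZ Thm. 3.3 at `χ₀`, TYZ p. 749 through `ϕ`, the
bridge displays carrying the two READING marks of record `tyzPhiParam` (P) and `tyzZN` (M5) — because the analytic
conversion needs it. This file records the DIVISION OF LABOUR in the kernel: the algebraic half — Monsky's odd-index
theorem for Tian's point — is a KERNEL THEOREM of the Galois skeleton alone:

* the displayed hypothesis is the BINDER `hSk : ∀ (p, q) ∈ 𝒮⁻, ∃ D : CMPointData (pq), D.PrintedCore ∧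
  D.GenusTheoryDisplaysCore` — the conjunction of Tian 2014 Thm. 2.8 (1)–(3), (4.8), the Galois facts on `i`, `√−2n`,
  `Gal(H(i)/K)` (`PrintedCore`, = `tian2014_system_sMinus_autCore`'s first conjunct) and Tian's Notations (i)–(iii) with
  the actions of `σ_{1+ϖ}`, `c` on `√p`, `√−q` (`GenusTheoryDisplaysCore`, its third conjunct): `hSys⁹` WITH THE WHOLE
  GROSS–ZAGIER CONJUNCT `GrossZagierAut` STRUCK (`skeleton_of_autCore`). No new named fact is filed (the hypothesis is a
  binder, as in `exists_printed_grossZagier_minusY_of_threeModEightSystem`); the typer may name it.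
* its conclusions, for every `(p, q) ∈ 𝒮⁻` and `N = 2pq` — all of them algebraic, none of them analytic:
  (M-y) the transplanted Thm. 4.7 + Thm. 5.5 / Thm. 5.9 (1): a representative set `φ` of `𝒜/[ϖ′]` and a RATIONAL point
  `y′ ∈ E_N(ℚ)` with `transfer y′ = y_{2pq,φ} = Σ_{t∈φ} z_t` and `y′ ∉ 2E_N(ℚ) + E_N(ℚ)_tor` (`minusY_of_skeleton`);
  rank `E_N(ℚ) = 1` (`y′` is non-torsion; `≤ 1` is the tree's first `2`-descent, p457453); `2pq` is a congruent number;
  `Ш(E_N)[2] = 0` and `Ш(E_N)[2^∞] = 0` (the tree's exact count `#Sel₂(E_N) = 8`, p522253, with rank `1`); and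
  **Monsky's odd-index sentence for `y′`**: `y′` has infinite order and ODD index — for every generator `g` of `E_N(ℚ)/tor`,
  `y′ − m·g` is torsion for some ODD `m` (`monskyOddIndex_sMinus_of_skeleton`).
* the same on ALL of Monsky's case (13) `{p ≡ 5 (8), q ≡ 3 (8)}`, either sign of `(p/q)` (prover-A g10's transplant
  `minusY_of_genusTheoryDisplays_three_mod_eight`): the genus conjunct «`[ϖ′] = [𝔭_p][𝔭_q]`» struck by the typer g12 on
  `𝒮⁻` is re-derived on `(13)⁺` from g10's `ramifiedClassActions_of_genusRule_plus` (`piPrime_eq_mul_of_genusRule_plus`).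

DIVISION OF LABOUR made explicit (paper §6 (Db), «In words»): the two reading marks of record and the whole Gross–Zagier
display serve clause (a) and the `2`-part ONLY; the odd-index theorem for Tian's point rests on Thm. 2.8's skeleton and
classical genus theory — every displayed sentence a printed statement of Tian 2014 §2 / §4.2 / Notations. Nothing is
asserted unconditionally beyond the tree's own descent theorems; the conjecture `Prop`s stay `@[conjecture]`.
[cite: Monsky1990MockHeegner, Thm. 5.14 (13)/(15) (p. 66), Cor. 5.15 (p. 66), Remark (2) and Remark (3) (p. 67), Thm. 4.7 (pp. 57–58), Thm. 5.5 (p. 62), Thm. 5.9 (1) (pp. 63–64)]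
[cite: Tian2014, Def. 2.7 (p0011 L25–L36), Thm. 2.8 (p0011 L37–L44 = J132), Remark 2.5 (p. 128), (4.8) (p0023 L46–L50), §4.2 (p0022 L52–L60), Notations (i)–(iii) (J122 L41–54)]
[cite: Lagrange1975, §11 table p. 16-12] [cite: SilvermanAEC2009, Prop. X.1.4, Thm. X.4.2, Thm. VIII.6.7]
[cite: TopYui2008Congruent, Prop. 3.3 (i) ⟺ (iv)]
-/

noncomputable section

open scoped Classical NumberTheorySymbols

open WeierstrassCurve NumberField Literature.NumberTheory.EllipticCurves
  Literature.NumberTheory.EllipticCurves.Rank1Residual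
  Literature.NumberTheory.EllipticCurves.Rank1Residual.Typed
  Literature.NumberTheory.EllipticCurves.Monsky1990
  Literature.NumberTheory.EllipticCurves.TianYuanZhang2017

set_option autoImplicit false

namespace Summit.BirchSwinnertonDyer.Rank1Residual.P2

open Conjectures Literature.NumberTheory.EllipticCurves.Tian2014

/-! ## §1 Odd index in the kernel: a point outside `2E + tor` has odd index against every generator -/

/-- **A point `y ∉ 2E_N(ℚ) + E_N(ℚ)_tor` has ODD index in `E_N(ℚ)/tor`**: for every generator `g` of the free part,
`y − m·g` is torsion for some odd `m` (if `m = 2m′`, then `y = 2·(m′g) + t`). Pure group theory in `E_N(ℚ)`.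
[cite: Monsky1990MockHeegner, Lemma 3.3 (3) and the Remark after it (p. 53)] -/
theorem exists_odd_isOfFinAddOrder_sub_zsmul_of_not_two_smul_add_torsion {N : ℕ}
    (y : (congruentNumberCurve N).toAffine.Point)
    (hy : ∀ z t : (congruentNumberCurve N).toAffine.Point, IsOfFinAddOrder t → y ≠ (2 : ℤ) • z + t)
    (g : (congruentNumberCurve N).toAffine.Point) (hg : GeneratesFreePartRat N g) :
    ∃ m : ℤ, Odd m ∧ IsOfFinAddOrder (y - m • g) := by
  obtain ⟨m, hm⟩ := hg y
  refine ⟨m, ?_, hm⟩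
  by_contra hodd
  obtain ⟨m', hm'⟩ := Int.not_odd_iff_even.mp hodd
  apply hy (m' • g) (y - m • g) hm
  have h2 : (2 : ℤ) • (m' • g) = m • g := by
    rw [← mul_zsmul, hm']; congr 1; ring
  rw [h2]; abel

/-- **A point `y ∉ 2E_N(ℚ) + E_N(ℚ)_tor` is not torsion** (`y = 2y + (−y)` with `−y` torsion). [folklore] -/
theorem not_isOfFinAddOrder_of_not_two_smul_add_torsion {N : ℕ}
    (y : (congruentNumberCurve N).toAffine.Point)
    (hy : ∀ z t : (congruentNumberCurve N).toAffine.Point, IsOfFinAddOrder t → y ≠ (2 : ℤ) • z + t) :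
    ¬ IsOfFinAddOrder y := fun h => hy y (-y) h.neg (by abel)

/-! ## §2 The genus conjunct «`[ϖ′] = [𝔭_p][𝔭_q]`» on the loud half of case (13) -/

/-- **«`[ϖ′] = [𝔭_p]·[𝔭_q]`» is a kernel theorem of Tian's Notations (i) and (iii) on `(13)⁺` as well** (`p ≡ 5 (8)`,
`q ≡ 3 (8)`, `(p/q) = +1`): the typer g12's argument (`piPrime_eq_mul_of_twoTorsion_of_genusRule`, on `𝒮⁻`) with the
roles of `[𝔭_p]`, `[𝔭_q]` exchanged — `σ_{[𝔭_p]}` negates `√p` and fixes `√−q`, `σ_{[𝔭_q]}` fixes `√p` and negates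
`√−q` (`ramifiedClassActions_of_genusRule_plus`), so `[𝔭_p] ≠ 1`, `[𝔭_q] ≠ 1`, `[𝔭_p] ≠ [𝔭_q]`, and the `2`-torsion
class `[𝔭_p][𝔭_q]` can only be `[ϖ′]`. [cite: Tian2014, Notations (i), (iii) (J122 L41–54 = p0005 L22–L41), §4.2 (p0022 L58–L60)]
[cite: Monsky1990MockHeegner, p. 52 ¶2–3] -/
theorem piPrime_eq_mul_of_genusRule_plus {p q : ℕ} (D : CMPointData (p * q)) (hp : p.Prime)
    (hq : q.Prime) (hp8 : p % 8 = 5) (hq8 : q % 8 = 3) (hpq : J(p | q) = 1) {sqrtP sqrtNegQ : D.H}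
    (hPs : sqrtP ^ 2 = p) (hQs : sqrtNegQ ^ 2 = -q) {cp cq : ClassGroup (𝓞 (GenusField (2 * (p * q))))}
    (hcp2 : cp * cp = 1) (hcq2 : cq * cq = 1)
    (h2tor : ∀ t : ClassGroup (𝓞 (GenusField (2 * (p * q)))), t * t = 1 → t = 1 ∨ t = D.piPrime ∨ t = cp ∨ t = cq)
    (r1 : D.art cp sqrtP = sqrtP ↔ J(2 * q | p) = 1) (r2 : D.art cp sqrtNegQ = sqrtNegQ ↔ J(p | q) = 1)
    (r3 : D.art cq sqrtP = sqrtP ↔ J(q | p) = 1) (r4 : D.art cq sqrtNegQ = sqrtNegQ ↔ J(2 * p | q) = 1) :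
    D.piPrime = cp * cq := by
  obtain ⟨hsP, hsQ⟩ := Monsky1990.sqrt_ne_zero_of_prime hp hq hPs hQs
  obtain ⟨hcpP, hcpQ, -, hcqQ⟩ :=
    ramifiedClassActions_of_genusRule_plus D.art hp8 hq8 hpq hPs hQs r1 r2 r3 r4
  have hcp1 : cp ≠ 1 := by
    intro h
    rw [h, map_one, AlgEquiv.one_apply] at hcpP
    exact hsP (CharZero.eq_neg_self_iff.mp hcpP)
  have hcq1 : cq ≠ 1 := by
    intro h
    rw [h, map_one, AlgEquiv.one_apply] at hcqQ
    exact hsQ (CharZero.eq_neg_self_iff.mp hcqQ)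
  have hcpcq : cp ≠ cq := by
    intro h
    rw [h, hcqQ] at hcpQ
    exact hsQ (CharZero.neg_eq_self_iff.mp hcpQ)
  have h2 : (cp * cq) * (cp * cq) = 1 := by
    rw [mul_mul_mul_comm, hcp2, hcq2, one_mul]
  rcases h2tor _ h2 with h | h | h | h
  · exfalso
    apply hcpcq
    calc cp = cp * (cq * cq) := by rw [hcq2, mul_one]
      _ = (cp * cq) * cq := by rw [mul_assoc]
      _ = cq := by rw [h, one_mul]
  · exact h.symm
  · exact absurd (mul_left_cancel (h.trans (mul_one cp).symm)) hcq1
  · exact absurd (mul_right_cancel (h.trans (one_mul cq).symm)) hcp1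

/-- **`GenusTheoryDisplays` from the core genus display on ALL of case (13)** (`p ≡ 5 (8)`, `q ≡ 3 (8)`, either sign):
the struck conjunct is supplied by `piPrime_eq_mul_of_twoTorsion_of_genusRule` on `(p/q) = −1` and by
`piPrime_eq_mul_of_genusRule_plus` on `(p/q) = +1`. [cite: Tian2014, Notations (i)–(iii) (J122 L41–54 = p0005 L22–L41)] -/
theorem genusTheoryDisplays_of_genusTheoryDisplaysCore_three_mod_eight {p q : ℕ} (D : CMPointData (p * q))
    (hp : p.Prime) (hq : q.Prime) (hp8 : p % 8 = 5) (hq8 : q % 8 = 3) (h : D.GenusTheoryDisplaysCore) :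
    D.GenusTheoryDisplays := by
  have hne : p ≠ q := fun h => by omega
  have hg : (p : ℤ).gcd q = 1 := by
    rw [Int.gcd_natCast_natCast]; exact (Nat.coprime_primes hp hq).mpr hne
  rcases jacobiSym.eq_one_or_neg_one hg with hj | hj
  · obtain ⟨sqrtP, sqrtNegQ, cp, cq, hPs, hQs, hcp2, hcq2, h2tor, hsq, r1, r2, r3, r4, hτP, hτQ, hcP, hcQ⟩ := h
    exact ⟨sqrtP, sqrtNegQ, cp, cq, hPs, hQs,
      piPrime_eq_mul_of_genusRule_plus D hp hq hp8 hq8 hj hPs hQs hcp2 hcq2 h2tor r1 r2 r3 r4,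
      hcp2, hcq2, h2tor, hsq, r1, r2, r3, r4, hτP, hτQ, hcP, hcQ⟩
  · exact D.genusTheoryDisplays_of_genusTheoryDisplaysCore hp hq hp8 (by omega) hj h

/-! ## §3 M-y on one skeleton system: `Printed ∧ GenusTheory` from the core displays, then Monsky's descent -/

/-- **M-y from the core skeleton displays on `𝒮⁻`**: `PrintedCore ∧ GenusTheoryDisplaysCore ⟹ y_{2pq} ∉ 2E(K)⁻ + E[2]`
— the core displays give the full ones (`genusTheoryDisplays_of_genusTheoryDisplaysCore`, `printedReduced_of_printedCore`,
`printed_of_printedReduced`), then Monsky's Thm. 5.5 / Thm. 5.9 (1) transplanted (`monskyDisplays_of_genusTheoryDisplays`,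
`minusY_of_monskyDisplays`). No Gross–Zagier input.
[cite: Monsky1990MockHeegner, Thm. 4.7 (pp. 57–58), Thm. 5.5 (p. 62), Thm. 5.9 (1) (pp. 63–64)]
[cite: Tian2014, Thm. 2.8 (p0011 L37–L44), (4.8) (p0023 L46–L50), Notations (i)–(iii) (J122 L41–54)] -/
theorem minusY_of_skeleton_two_mul_five_mul {p q : ℕ} (D : CMPointData (p * q)) (hp : p.Prime) (hq : q.Prime)
    (hp5 : p % 8 = 5) (hq4 : q % 4 = 3) (hj : J(p | q) = -1) (hP : D.PrintedCore)
    (hG : D.GenusTheoryDisplaysCore) : D.MinusY (Nat.mul_ne_zero hp.ne_zero hq.ne_zero) := by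
  have hG' : D.GenusTheoryDisplays := D.genusTheoryDisplays_of_genusTheoryDisplaysCore hp hq hp5 hq4 hj hG
  have hP' : D.Printed := D.printed_of_printedReduced
    (D.printedReduced_of_printedCore hP (D.piPrime_mul_piPrime_of_genusTheoryDisplays hG'))
  exact D.minusY_of_monskyDisplays _
    (squarefree_two_mul_mul_of_primes hp hq (by omega) (by omega) (fun h => by omega)) hP'
    (D.monskyDisplays_of_genusTheoryDisplays hP' hp hq hp5 hq4 hj hG')

/-- **M-y from the core skeleton displays on ALL of case (13)** (`p ≡ 5 (8)`, `q ≡ 3 (8)`, either sign of `(p/q)`):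
Monsky's Thm. 5.5 transplanted without the Legendre proviso (prover-A g10), now from the core displays.
[cite: Monsky1990MockHeegner, Thm. 5.5 (p. 62), Thm. 5.14 (13) (p. 66)] -/
theorem minusY_of_skeleton_three_mod_eight {p q : ℕ} (D : CMPointData (p * q)) (hp : p.Prime) (hq : q.Prime)
    (hp8 : p % 8 = 5) (hq8 : q % 8 = 3) (hP : D.PrintedCore) (hG : D.GenusTheoryDisplaysCore) :
    D.MinusY (Nat.mul_ne_zero hp.ne_zero hq.ne_zero) := by
  have hG' : D.GenusTheoryDisplays := genusTheoryDisplays_of_genusTheoryDisplaysCore_three_mod_eight D hp hq hp8 hq8 hG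
  have hP' : D.Printed := D.printed_of_printedReduced
    (D.printedReduced_of_printedCore hP (D.piPrime_mul_piPrime_of_genusTheoryDisplays hG'))
  exact D.minusY_of_genusTheoryDisplays_three_mod_eight hP' hp hq hp8 hq8 hG'

/-! ## §4 The family: rank one, congruent, `Ш[2^∞] = 0` and Monsky's sentence from the skeleton binder ALONE -/

/-- **The skeleton binder is a projection of the corner's displayed fact**: `hSys⁹ = tian2014_system_sMinus_autCore`
(and so `hSys⁷`, `hSys⁸`) gives the skeleton — the Gross–Zagier conjunct is simply dropped.
[cite: Tian2014, Thm. 2.8 (p0011 L37–L44), Notations (i)–(iii) (J122 L41–54)] [folklore] -/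
theorem skeleton_of_autCore (h : tian2014_system_sMinus_autCore) :
    ∀ p q : ℕ, (hp : p.Prime) → (hq : q.Prime) → p % 8 = 5 → q % 4 = 3 → jacobiSym p q = -1 →
      ∃ D : CMPointData (p * q), D.PrintedCore ∧ D.GenusTheoryDisplaysCore := by
  intro p q hp hq hp5 hq4 hj
  obtain ⟨D, hP, -, hG⟩ := h p q hp hq hp5 hq4 hj
  exact ⟨D, hP, hG⟩

/-- The skeleton binder from the corner of record's displayed fact `hSys⁸` (ROUND 742). [folklore] -/
theorem skeleton_of_autReduced (h : tian2014_system_sMinus_autReduced) :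
    ∀ p q : ℕ, (hp : p.Prime) → (hq : q.Prime) → p % 8 = 5 → q % 4 = 3 → jacobiSym p q = -1 →
      ∃ D : CMPointData (p * q), D.PrintedCore ∧ D.GenusTheoryDisplaysCore :=
  skeleton_of_autCore (tian2014_system_sMinus_autCore_of_autReduced h)

/-- **Rank `E_{2pq}(ℚ) = 1` on all of `𝒮⁻` from the skeleton binder alone** — the system's own rational point
`y′ ∉ 2E + tor` (M-y) is non-torsion, `≤ 1` is the tree's first `2`-descent. No Gross–Zagier, no `2`-Selmer display.
[cite: Lagrange1975, §11 table p. 16-12] [cite: Monsky1990MockHeegner, Thm. 5.5 (p. 62), Thm. 5.9 (1) (pp. 63–64)] -/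
theorem mordellWeilRank_eq_one_of_skeleton_rankDescent
    (hSk : ∀ p q : ℕ, (hp : p.Prime) → (hq : q.Prime) → p % 8 = 5 → q % 4 = 3 → jacobiSym p q = -1 →
      ∃ D : CMPointData (p * q), D.PrintedCore ∧ D.GenusTheoryDisplaysCore) :
    ∀ p q : ℕ, p.Prime → q.Prime → p % 8 = 5 → q % 4 = 3 → jacobiSym p q = -1 →
      (congruentNumberCurve (2 * (p * q))).mordellWeilRank = 1 := by
  intro p q hp hq hp5 hq4 hj
  obtain ⟨D, hP, hG⟩ := hSk p q hp hq hp5 hq4 hj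
  obtain ⟨-, -, y', -, hnot⟩ := minusY_of_skeleton_two_mul_five_mul D hp hq hp5 hq4 hj hP hG
  exact mordellWeilRank_eq_one_of_not_two_smul_add_torsion_two_mul_five_mul hp hq hp5 hq4 y' hnot

/-- **`2pq` is a congruent number for every `(p, q) ∈ 𝒮⁻`, from the skeleton binder alone** (Monsky 1990 Cor. 5.15's
congruent-number clause on the silent half). [cite: Monsky1990MockHeegner, Cor. 5.15 (2′) (p. 66)]
[cite: TopYui2008Congruent, Prop. 3.3 (i) ⟺ (iv)] -/
theorem isCongruentNumber_two_mul_five_mul_of_skeleton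
    (hSk : ∀ p q : ℕ, (hp : p.Prime) → (hq : q.Prime) → p % 8 = 5 → q % 4 = 3 → jacobiSym p q = -1 →
      ∃ D : CMPointData (p * q), D.PrintedCore ∧ D.GenusTheoryDisplaysCore) :
    ∀ p q : ℕ, p.Prime → q.Prime → p % 8 = 5 → q % 4 = 3 → jacobiSym p q = -1 →
      IsCongruentNumber (2 * (p * q)) := fun p q hp hq hp5 hq4 hj =>
  (Wiles2000.mordellWeilRank_ne_zero_iff_isCongruentNumber
    (mul_pos two_pos (mul_pos hp.pos hq.pos))).mp
    (by rw [mordellWeilRank_eq_one_of_skeleton_rankDescent hSk p q hp hq hp5 hq4 hj]; exact one_ne_zero)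

/-- **`Ш(E_{2pq})[2^∞] = 0` on all of `𝒮⁻` from the skeleton binder alone**: rank one and the tree's exact count
`#Sel₂(E_{2pq}) = 8` (`isCongruentNumber_iff_primaryComponent_sha_two_eq_bot`). [cite: SilvermanAEC2009, Thm. X.4.2]
[cite: Monsky1990MockHeegner, Cor. 5.15 (2′) (p. 66), Remark (2) (p. 67)] -/
theorem primaryComponent_sha_two_eq_bot_of_skeleton
    (hSk : ∀ p q : ℕ, (hp : p.Prime) → (hq : q.Prime) → p % 8 = 5 → q % 4 = 3 → jacobiSym p q = -1 →
      ∃ D : CMPointData (p * q), D.PrintedCore ∧ D.GenusTheoryDisplaysCore) :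
    ∀ p q : ℕ, (hp : p.Prime) → (hq : q.Prime) → p % 8 = 5 → q % 4 = 3 → jacobiSym p q = -1 →
      haveI := isElliptic_congruentNumberCurve (n := 2 * (p * q))
        (Nat.mul_ne_zero two_ne_zero (Nat.mul_ne_zero hp.ne_zero hq.ne_zero))
      AddCommGroup.primaryComponent (congruentNumberCurve (2 * (p * q))).sha 2 = ⊥ :=
  fun p q hp hq hp5 hq4 hj =>
    (isCongruentNumber_iff_primaryComponent_sha_two_eq_bot hp hq hp5 hq4).mp
      (isCongruentNumber_two_mul_five_mul_of_skeleton hSk p q hp hq hp5 hq4 hj)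

/-- **`Ш(E_{2pq})[2] = 0` on all of `𝒮⁻` from the skeleton binder alone.** [cite: SilvermanAEC2009, Thm. X.4.2] -/
theorem sha_inf_torsionBy_two_eq_bot_of_skeleton
    (hSk : ∀ p q : ℕ, (hp : p.Prime) → (hq : q.Prime) → p % 8 = 5 → q % 4 = 3 → jacobiSym p q = -1 →
      ∃ D : CMPointData (p * q), D.PrintedCore ∧ D.GenusTheoryDisplaysCore) :
    ∀ p q : ℕ, (hp : p.Prime) → (hq : q.Prime) → p % 8 = 5 → q % 4 = 3 → jacobiSym p q = -1 →
      haveI := isElliptic_congruentNumberCurve (n := 2 * (p * q))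
        (Nat.mul_ne_zero two_ne_zero (Nat.mul_ne_zero hp.ne_zero hq.ne_zero))
      ((congruentNumberCurve (2 * (p * q))).sha ⊓
        AddSubgroup.torsionBy (congruentNumberCurve (2 * (p * q))).galH1 ((2 : ℕ) : ℤ) :
          AddSubgroup (congruentNumberCurve (2 * (p * q))).galH1) = ⊥ :=
  fun p q hp hq hp5 hq4 hj =>
    (mordellWeilRank_eq_one_iff_sha_inf_torsionBy_two_eq_bot hp hq hp5 hq4).mp
      (mordellWeilRank_eq_one_of_skeleton_rankDescent hSk p q hp hq hp5 hq4 hj)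

/-- **MONSKY'S ODD-INDEX THEOREM FOR TIAN'S HEEGNER POINT, on the silent half `𝒮⁻`, from the skeleton binder alone** (Monsky
1990 Thm. 5.14 (13)/(15) with Remark (2): «the subgroup generated by `S_N` and `T` is of odd index» and `rank E_N(ℚ) = 1` —
PRINTED for Monsky's `S_N`; here RE-PROVED for Tian's `y_{2pq}`, the Heegner point of the first proof, which is not `S_N`
in print): for every `(p, q) ∈ 𝒮⁻` and every skeleton system `D`, there are a representative set `φ` of `𝒜/[ϖ′]` and a
rational point `y′ ∈ E_{2pq}(ℚ)` with `transfer y′ = y_{2pq,φ} = Σ_{t∈φ} z_t`, such that `y′` has INFINITE ORDER and ODD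
INDEX: for every generator `g` of `E_{2pq}(ℚ)/tor` (there is one: rank `1`), `y′ − m·g` is torsion for some odd `m`.
No `L`-function, no Gross–Zagier display, no `2`-Selmer display, no reading mark.
[cite: Monsky1990MockHeegner, Thm. 5.14 (13)/(15) (p. 66), Remark (2) (p. 67), Thm. 4.7 (pp. 57–58), Thm. 5.5 (p. 62), Thm. 5.9 (1) (pp. 63–64)]
[cite: Tian2014, Def. 2.7 (p0011 L25–L36), Thm. 2.8 (p0011 L37–L44), Remark 2.5 (p. 128), (4.5) (p0022 L84–L96), (4.8) (p0023 L46–L50)] -/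
theorem monskyOddIndex_sMinus_of_skeleton
    (hSk : ∀ p q : ℕ, (hp : p.Prime) → (hq : q.Prime) → p % 8 = 5 → q % 4 = 3 → jacobiSym p q = -1 →
      ∃ D : CMPointData (p * q), D.PrintedCore ∧ D.GenusTheoryDisplaysCore) :
    ∀ p q : ℕ, (hp : p.Prime) → (hq : q.Prime) → p % 8 = 5 → q % 4 = 3 → jacobiSym p q = -1 →
      ∃ D : CMPointData (p * q), D.PrintedCore ∧ D.GenusTheoryDisplaysCore ∧
        ∃ φ, D.IsRepsModPiPrime φ ∧ ∃ y' : (congruentNumberCurve (2 * (p * q))).toAffine.Point,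
          D.transfer (Nat.mul_ne_zero hp.ne_zero hq.ne_zero) y' = D.yPoint φ ∧
          ¬ IsOfFinAddOrder y' ∧
          (∀ g : (congruentNumberCurve (2 * (p * q))).toAffine.Point, GeneratesFreePartRat (2 * (p * q)) g →
            ∃ m : ℤ, Odd m ∧ IsOfFinAddOrder (y' - m • g)) := by
  intro p q hp hq hp5 hq4 hj
  obtain ⟨D, hP, hG⟩ := hSk p q hp hq hp5 hq4 hj
  obtain ⟨φ, hφ, y', hy', hnot⟩ := minusY_of_skeleton_two_mul_five_mul D hp hq hp5 hq4 hj hP hG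
  exact ⟨D, hP, hG, φ, hφ, y', hy', not_isOfFinAddOrder_of_not_two_smul_add_torsion y' hnot,
    fun g hg => exists_odd_isOfFinAddOrder_sub_zsmul_of_not_two_smul_add_torsion y' hnot g hg⟩

/-- DEPRECATED original name of `monskyOddIndex_sMinus_of_skeleton` (same statement): the first filing called this
Monsky's «conjecture as printed»; at `ℓ = 2` the odd-index statement is Monsky's THEOREM (Thm. 5.14 (13)/(15) with
Remark (2)), re-proved here for Tian's point — read it under the corrected name. [cite: Monsky1990MockHeegner, Thm. 5.14 (13)/(15) (p. 66), Remark (2) (p. 67)] -/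
@[deprecated monskyOddIndex_sMinus_of_skeleton (since := "2026-08-27")]
alias monskyConjecture_sMinus_of_skeleton := monskyOddIndex_sMinus_of_skeleton

/-- **A generator exists and Tian's point is a rational point of odd index against it** — the conjunction
«rank one ∧ a generator `g` ∧ `y′` of odd index against `g`» in one statement, from the skeleton binder alone.
[cite: Monsky1990MockHeegner, Thm. 5.14 (13)/(15) (p. 66), Remark (2) (p. 67)] [cite: SilvermanAEC2009, Thm. VIII.6.7] -/
theorem exists_generator_and_oddIndex_of_skeleton
    (hSk : ∀ p q : ℕ, (hp : p.Prime) → (hq : q.Prime) → p % 8 = 5 → q % 4 = 3 → jacobiSym p q = -1 →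
      ∃ D : CMPointData (p * q), D.PrintedCore ∧ D.GenusTheoryDisplaysCore) :
    ∀ p q : ℕ, (hp : p.Prime) → (hq : q.Prime) → p % 8 = 5 → q % 4 = 3 → jacobiSym p q = -1 →
      (congruentNumberCurve (2 * (p * q))).mordellWeilRank = 1 ∧
      ∃ g : (congruentNumberCurve (2 * (p * q))).toAffine.Point, GeneratesFreePartRat (2 * (p * q)) g ∧
        ∃ D : CMPointData (p * q), ∃ φ, D.IsRepsModPiPrime φ ∧
          ∃ y' : (congruentNumberCurve (2 * (p * q))).toAffine.Point,
            D.transfer (Nat.mul_ne_zero hp.ne_zero hq.ne_zero) y' = D.yPoint φ ∧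
            ∃ m : ℤ, Odd m ∧ IsOfFinAddOrder (y' - m • g) := by
  intro p q hp hq hp5 hq4 hj
  have hrank := mordellWeilRank_eq_one_of_skeleton_rankDescent hSk p q hp hq hp5 hq4 hj
  obtain ⟨g, hg, -⟩ := exists_generatesFreePartRat_of_mordellWeilRank_eq_one
    (Nat.mul_ne_zero two_ne_zero (Nat.mul_ne_zero hp.ne_zero hq.ne_zero)) hrank
  obtain ⟨D, -, -, φ, hφ, y', hy', -, hodd⟩ := monskyOddIndex_sMinus_of_skeleton hSk p q hp hq hp5 hq4 hj
  exact ⟨hrank, g, hg, D, φ, hφ, y', hy', hodd g hg⟩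

/-! ## §5 The same on all of Monsky's case (13) (`q ≡ 3 (8)`, either sign of `(p/q)`) -/

/-- **Monsky's Theorem 5.14 (13) with Remark (2), for Tian's point, from the skeleton binder on `{p ≡ 5 (8), q ≡ 3 (8)}`,
either sign**: `y′` of infinite order and odd index, rank one, `2pq` congruent, `Ш[2^∞] = 0` — on the loud quarter
`(p/q) = +1` a Gross–Zagier-free second proof of what TYZ's criterion gives there (prover-A g10's transplant), from the
core displays. [cite: Monsky1990MockHeegner, Thm. 5.5 (p. 62), Thm. 5.14 (13) (p. 66), Remark (2) (p. 67)] [cite: Lagrange1975, §11 table p. 16-12] -/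
theorem monskyOddIndex_three_mod_eight_of_skeleton
    (hSk : ∀ p q : ℕ, (hp : p.Prime) → (hq : q.Prime) → p % 8 = 5 → q % 8 = 3 →
      ∃ D : CMPointData (p * q), D.PrintedCore ∧ D.GenusTheoryDisplaysCore) :
    ∀ p q : ℕ, (hp : p.Prime) → (hq : q.Prime) → p % 8 = 5 → q % 8 = 3 →
      (congruentNumberCurve (2 * (p * q))).mordellWeilRank = 1 ∧ IsCongruentNumber (2 * (p * q)) ∧
      (haveI := isElliptic_congruentNumberCurve (n := 2 * (p * q))
        (Nat.mul_ne_zero two_ne_zero (Nat.mul_ne_zero hp.ne_zero hq.ne_zero))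
       AddCommGroup.primaryComponent (congruentNumberCurve (2 * (p * q))).sha 2 = ⊥) ∧
      ∃ D : CMPointData (p * q), ∃ φ, D.IsRepsModPiPrime φ ∧
        ∃ y' : (congruentNumberCurve (2 * (p * q))).toAffine.Point,
          D.transfer (Nat.mul_ne_zero hp.ne_zero hq.ne_zero) y' = D.yPoint φ ∧ ¬ IsOfFinAddOrder y' ∧
          (∀ g : (congruentNumberCurve (2 * (p * q))).toAffine.Point, GeneratesFreePartRat (2 * (p * q)) g →
            ∃ m : ℤ, Odd m ∧ IsOfFinAddOrder (y' - m • g)) := by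
  intro p q hp hq hp8 hq8
  obtain ⟨D, hP, hG⟩ := hSk p q hp hq hp8 hq8
  obtain ⟨φ, hφ, y', hy', hnot⟩ := minusY_of_skeleton_three_mod_eight D hp hq hp8 hq8 hP hG
  have hrank : (congruentNumberCurve (2 * (p * q))).mordellWeilRank = 1 :=
    mordellWeilRank_eq_one_of_not_two_smul_add_torsion_two_mul_five_mul hp hq hp8 (by omega) y' hnot
  have hcong : IsCongruentNumber (2 * (p * q)) :=
    (Wiles2000.mordellWeilRank_ne_zero_iff_isCongruentNumber (mul_pos two_pos (mul_pos hp.pos hq.pos))).mp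
      (by rw [hrank]; exact one_ne_zero)
  refine ⟨hrank, hcong, (isCongruentNumber_iff_primaryComponent_sha_two_eq_bot hp hq hp8 (by omega)).mp hcong,
    D, φ, hφ, y', hy', not_isOfFinAddOrder_of_not_two_smul_add_torsion y' hnot,
    fun g hg => exists_odd_isOfFinAddOrder_sub_zsmul_of_not_two_smul_add_torsion y' hnot g hg⟩

/-- DEPRECATED original name of `monskyOddIndex_three_mod_eight_of_skeleton` (same statement); see the note on
`monskyConjecture_sMinus_of_skeleton`. [cite: Monsky1990MockHeegner, Thm. 5.14 (13) (p. 66), Remark (2) (p. 67)] -/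
@[deprecated monskyOddIndex_three_mod_eight_of_skeleton (since := "2026-08-27")]
alias monskyConjecture_three_mod_eight_of_skeleton := monskyOddIndex_three_mod_eight_of_skeleton

end Summit.BirchSwinnertonDyer.Rank1Residual.P2

end
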